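/-
Copyright (c) 2026. All rights reserved.
Released under Apache 2.0 license as described in the file LICENSE.
Authors: abc-iut cell, wave-2 seat abc-iut-L3-t11 (merge adapter abc-iut-S1 → abc-iut-L4-t3).
-/
import Literature.AnabelianGeometry.AbsoluteAnabelian.LogShells
import Literature.IUT.LogVolume.LogSeriesEstimates
import HarnessLib

/-!
# [AbsTopIII] Def 5.4 (iii): the REAL `p`-adic logarithm as an instance of `PadicLogOnUnits`

S. Mochizuki, *Topics in absolute anabelian geometry III*, J. Math. Sci. Univ. Tokyo 22 (2015)
[MochizukiAbsTopIII2015], Def 5.4 (iii), manuscript p. 126: "the `p_k`-adic logarithm determines a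
bijection `1 + p*_k·𝒪_k ≅ p*_k·𝒪_k`", `p*_k := p_k` (`p_k` odd), `p_k²` (`p_k = 2`).

Seat abc-iut-L4-t3 typed the nonarchimedean log-shell of Def 5.4 (iii) (`LogShells.lean`, p403899) over
the HYPOTHESIS STRUCTURE `PadicLogOnUnits K` — a map `log : K → K`, an element `pstar : K`, and the two
printed properties `image_principalUnits : log '' closedBall 1 ‖pstar‖ = closedBall 0 ‖pstar‖`,
`injOn_principalUnits` — flagged `TODO-merge abc-iut-S1`. Seat abc-iut-S1 has landed the analytic
`p`-adic logarithm `unitLog = log_p : 𝒪_K^× → K` of a mixed-characteristic nonarchimedean local field in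
the norm-side setting (`Literature.IUT.LogVolume.LocalUnitLog`, p403893) together with the
successive-approximation bijection of the logarithmic series `L` between `{‖1 − y‖ ≤ ρ}` and `{‖z‖ ≤ ρ}`
whenever `θ := ρ·p^{1/(p−1)} < 1` (`logSeries_image_closedBall`, `logSeries_injOn`,
`Literature.IUT.LogVolume.LogSeriesEstimates`, p404172; Koblitz GTM 58 Ch. IV §1–2).

This file is the MERGE: the standard model

  `PadicLogOnUnits.ofUnitLog p K : PadicLogOnUnits K`, `log := unitLog`, `pstar := p*` (`p`, resp. `4`),

with both axioms PROVED (at `ρ = ‖p*‖` one has `θ = p^{1/(p−1)−1} < 1` for odd `p` and `θ = 2⁻²·2 = 2⁻¹`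
for `p = 2` — `norm_pstarNat_mul_rpow_lt_one`; this is why the text squares `2`). Consequences recorded:
`preLogShell (ofUnitLog p K) = log_p(𝒪_K^×)` (S1's `logUnits K`), `logShell (ofUnitLog p K) = (p*)⁻¹ • log_p(𝒪_K^×)`,
and Def 5.4 (iii)'s inclusion `𝒪_k ⊆ ℐ_k` UNCONDITIONALLY (`closedBall_subset_logShell_ofUnitLog`, from
abc-iut-L4-t3's `closedBall_subset_logShell`); `pstar` agrees with `MLFType.pstar` (ref-b PASS-8 B9).
Setting: `K` a nontrivially normed field, normed `ℚ_p`-algebra, ultrametric, complete (every finite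
extension of `ℚ_p`; properness is not needed here). Classical and undisputed; nothing here bears on
[IUTchIII] Cor. 3.12.
-/

set_option autoImplicit false

noncomputable section

open Set Metric
open scoped Pointwise

namespace Literature.AnabelianGeometry.AbsoluteAnabelian

open Literature.IUT.LogVolume Literature.NumberTheory.Transcendental

variable (p : ℕ) [hp : Fact p.Prime]
variable (K : Type*) [NontriviallyNormedField K] [instK : NormedAlgebra ℚ_[p] K]

/-! ## The element `p*` of `K` and the contraction constant at radius `‖p*‖` -/

/-- `p* ≠ 0` in `K` (`p* = p^{1 or 2}`, characteristic `0`).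
[cite: MochizukiAbsTopIII2015, Def 5.4 (iii) p. 126] -/
theorem pstarNat_cast_ne_zero : ((p ^ (if p = 2 then 2 else 1) : ℕ) : K) ≠ 0 := by
  haveI := IwasawaLog.charZero p (F := K)
  exact_mod_cast pow_ne_zero _ (Fact.out : p.Prime).ne_zero

/-- `‖p*‖ = p⁻¹` for odd `p` and `= p⁻²` for `p = 2`, written as `(p⁻¹)^{1 or 2}`.
[cite: MochizukiAbsTopIII2015, Def 5.4 (iii) p. 126] -/
theorem norm_pstarNat_cast :
    ‖((p ^ (if p = 2 then 2 else 1) : ℕ) : K)‖ = (p : ℝ)⁻¹ ^ (if p = 2 then 2 else 1) := by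
  rw [Nat.cast_pow, norm_pow, IwasawaLog.norm_natCast p p, Padic.norm_p]

/-- **Why `p* = p²` for `p = 2`**: at radius `ρ := ‖p*‖` the contraction constant `θ := ρ · p^{1/(p−1)}`
of the logarithmic series is `< 1` for every prime `p` (`p` odd: `θ = p^{1/(p−1) − 1}`; `p = 2`:
`θ = 2⁻² · 2 = 2⁻¹`). [cite: MochizukiAbsTopIII2015, Def 5.4 (iii) p. 126] -/
theorem norm_pstarNat_mul_rpow_lt_one :
    ‖((p ^ (if p = 2 then 2 else 1) : ℕ) : K)‖ * (p : ℝ) ^ (1 / ((p : ℝ) - 1)) < 1 := by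
  have hp : p.Prime := Fact.out
  have hp1 : (1 : ℝ) < p := by exact_mod_cast hp.one_lt
  rw [norm_pstarNat_cast p K]
  by_cases h2 : p = 2
  · subst h2
    rw [if_pos rfl]
    norm_num
  · have h3 : (3 : ℝ) ≤ p := by exact_mod_cast (show 3 ≤ p by have := hp.two_le; omega)
    rw [if_neg h2, pow_one, ← Real.rpow_neg_one, ← Real.rpow_add (by linarith)]
    apply Real.rpow_lt_one_of_one_lt_of_neg hp1
    have : 1 / ((p : ℝ) - 1) < 1 := (div_lt_one (by linarith)).mpr (by linarith)
    linarith

/-- `‖p*‖ < 1` (`p*` lies in the maximal ideal). [cite: MochizukiAbsTopIII2015, Def 5.4 (iii) p. 126] -/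
theorem norm_pstarNat_cast_lt_one : ‖((p ^ (if p = 2 then 2 else 1) : ℕ) : K)‖ < 1 := by
  have hp1 : (1 : ℝ) ≤ p := by exact_mod_cast (Fact.out : p.Prime).one_lt.le
  have hq : 1 ≤ (p : ℝ) ^ (1 / ((p : ℝ) - 1)) :=
    Real.one_le_rpow hp1 (div_nonneg zero_le_one (by linarith))
  calc ‖((p ^ (if p = 2 then 2 else 1) : ℕ) : K)‖
        = ‖((p ^ (if p = 2 then 2 else 1) : ℕ) : K)‖ * 1 := (mul_one _).symm
    _ ≤ ‖((p ^ (if p = 2 then 2 else 1) : ℕ) : K)‖ * (p : ℝ) ^ (1 / ((p : ℝ) - 1)) := by gcongr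
    _ < 1 := norm_pstarNat_mul_rpow_lt_one p K

variable [instU : IsUltrametricDist K] [instC : CompleteSpace K]

/-- On the ball `1 + p*·𝒪_K` S1's `unitLog = log_p` IS the logarithmic series `L` (its elements are
principal units). [cite: MochizukiAbsTopIII2015, Def 5.4 (iii) p. 126] -/
theorem unitLog_eqOn_logSeries_closedBall :
    EqOn unitLog logSeries (closedBall (1 : K) ‖((p ^ (if p = 2 then 2 else 1) : ℕ) : K)‖) := by
  intro y hy
  rw [mem_closedBall, dist_eq_norm, norm_sub_rev] at hy
  exact unitLog_of_isPrincipal p (hy.trans_lt (norm_pstarNat_cast_lt_one p K))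

omit hp instK instU instC in
/-- `1 + p*·𝒪_K = closedBall 1 ‖p*‖` is S1's set `{‖1 − y‖ ≤ ‖p*‖}`.
[cite: MochizukiAbsTopIII2015, Def 5.4 (iii) p. 126] -/
theorem closedBall_one_eq_setOf (r : ℝ) : closedBall (1 : K) r = {y : K | ‖1 - y‖ ≤ r} := by
  ext y
  rw [mem_closedBall, dist_eq_norm, norm_sub_rev, mem_setOf_eq]

omit hp instK instU instC in
/-- `p*·𝒪_K = closedBall 0 ‖p*‖` is S1's set `{‖z‖ ≤ ‖p*‖}`. [cite: MochizukiAbsTopIII2015, Def 5.4 (iii) p. 126] -/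
theorem closedBall_zero_eq_setOf (r : ℝ) : closedBall (0 : K) r = {z : K | ‖z‖ ≤ r} := by
  ext z
  rw [mem_closedBall, dist_zero_right, mem_setOf_eq]

/-! ## The instance -/

/-- **The standard model of `PadicLogOnUnits K`** (Def 5.4 (iii): "the `p_k`-adic logarithm determines a
bijection `1 + p*_k·𝒪_k ≅ p*_k·𝒪_k`"): `log := log_p` = abc-iut-S1's `unitLog` (junk `0` off the unit
sphere), `pstar := p*` (`p` for odd `p`, `p² = 4` for `p = 2`), the image equality and the injectivity on
`1 + p*·𝒪_k` PROVED from `logSeries_image_closedBall` / `logSeries_injOn` at `ρ = ‖p*‖`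
(`θ = ‖p*‖·p^{1/(p−1)} < 1`). This retires the `TODO-merge abc-iut-S1` flag of `LogShells.lean` for
complete `K`. [cite: MochizukiAbsTopIII2015, Def 5.4 (iii) p. 126] -/
def PadicLogOnUnits.ofUnitLog : PadicLogOnUnits K where
  log := unitLog
  pstar := ((p ^ (if p = 2 then 2 else 1) : ℕ) : K)
  pstar_ne_zero := pstarNat_cast_ne_zero p K
  norm_pstar_lt_one := norm_pstarNat_cast_lt_one p K
  image_principalUnits := by
    rw [(unitLog_eqOn_logSeries_closedBall p K).image_eq, closedBall_one_eq_setOf,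
      closedBall_zero_eq_setOf]
    exact logSeries_image_closedBall p K (norm_pstarNat_mul_rpow_lt_one p K)
  injOn_principalUnits := by
    refine InjOn.congr ?_ (unitLog_eqOn_logSeries_closedBall p K).symm
    rw [closedBall_one_eq_setOf]
    exact logSeries_injOn p K (norm_pstarNat_mul_rpow_lt_one p K)

/-- The logarithm of the standard model is S1's `unitLog = log_p`. [cite: MochizukiAbsTopIII2015, Def 5.4 (iii) p. 126] -/
@[simp] theorem PadicLogOnUnits.ofUnitLog_log : (PadicLogOnUnits.ofUnitLog p K).log = unitLog := rfl

/-- `pstar` of the standard model is `p* = p^{1 or 2}`. [cite: MochizukiAbsTopIII2015, Def 5.4 (iii) p. 126] -/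
@[simp] theorem PadicLogOnUnits.ofUnitLog_pstar :
    (PadicLogOnUnits.ofUnitLog p K).pstar = ((p ^ (if p = 2 then 2 else 1) : ℕ) : K) := rfl

/-- For odd `p`, `pstar = p`. [cite: MochizukiAbsTopIII2015, Def 5.4 (iii) p. 126] -/
theorem PadicLogOnUnits.ofUnitLog_pstar_of_ne_two (h : p ≠ 2) :
    (PadicLogOnUnits.ofUnitLog p K).pstar = (p : K) := by
  rw [PadicLogOnUnits.ofUnitLog_pstar, if_neg h, pow_one]

/-- For `p = 2`, `pstar = p² = 4`. [cite: MochizukiAbsTopIII2015, Def 5.4 (iii) p. 126] -/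
theorem PadicLogOnUnits.ofUnitLog_pstar_of_eq_two (h : p = 2) :
    (PadicLogOnUnits.ofUnitLog p K).pstar = (p : K) ^ 2 := by
  rw [PadicLogOnUnits.ofUnitLog_pstar, if_pos h, Nat.cast_pow]

/-- `pstar` of the standard model is the `p*` of the numerical type of any MLF of residue characteristic
`p` (abc-iut-L4-t3's `MLFType.pstar`; ref-b PASS-8 B9: the instance pins `pstar` to the residue
characteristic). [cite: MochizukiAbsTopIII2015, Prop 5.8 (i) p. 139] -/
theorem PadicLogOnUnits.ofUnitLog_pstar_eq_MLFType (t : MLFType) (ht : t.p = p) :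
    (PadicLogOnUnits.ofUnitLog p K).pstar = (t.pstar : K) := by
  rw [PadicLogOnUnits.ofUnitLog_pstar, MLFType.pstar_eq_pow, ht]

/-! ## The log-shell of the standard model -/

/-- The pre-log-shell `ℐ* = log(𝒪_k^×)` of the standard model is S1's `log_p(R^×) = logUnits K` (the
UNSCALED pre-log-shell of Def 3.1 (iv)). [cite: MochizukiAbsTopIII2015, Def 5.4 (iii) p. 126] -/
theorem preLogShell_ofUnitLog : preLogShell (PadicLogOnUnits.ofUnitLog p K) = logUnits K := by
  unfold preLogShell logUnits
  rw [PadicLogOnUnits.ofUnitLog_log]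
  congr 1
  ext u
  rw [mem_sphere_zero_iff_norm, mem_setOf_eq]

/-- The log-shell `ℐ = (p*)⁻¹ · ℐ*` of the standard model is `(p*)⁻¹ • log_p(R^×)`.
[cite: MochizukiAbsTopIII2015, Def 5.4 (iii) p. 126] -/
theorem logShell_ofUnitLog :
    logShell (PadicLogOnUnits.ofUnitLog p K) =
      ((p ^ (if p = 2 then 2 else 1) : ℕ) : K)⁻¹ • logUnits K := by
  rw [logShell, preLogShell_ofUnitLog, PadicLogOnUnits.ofUnitLog_pstar]

/-- **Def 5.4 (iii), `𝒪_{k~}^{Π_k} ⊆ ℐ` — now UNCONDITIONAL**: `𝒪_k = closedBall 0 1 ⊆ ℐ_k` for the real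
`p`-adic logarithm (abc-iut-L4-t3's `closedBall_subset_logShell` applied to the standard model).
[cite: MochizukiAbsTopIII2015, Def 5.4 (iii) p. 126] -/
theorem closedBall_subset_logShell_ofUnitLog :
    closedBall (0 : K) 1 ⊆ logShell (PadicLogOnUnits.ofUnitLog p K) :=
  closedBall_subset_logShell (PadicLogOnUnits.ofUnitLog p K)

/-- … equivalently `𝒪_k ⊆ (p*)⁻¹ • log_p(𝒪_k^×)`, i.e. `p* · 𝒪_k ⊆ log_p(𝒪_k^×)` in S1's vocabulary.
[cite: MochizukiAbsTopIII2015, Def 5.4 (iii) p. 126] -/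
theorem closedBall_subset_smul_logUnits :
    closedBall (0 : K) 1 ⊆ ((p ^ (if p = 2 then 2 else 1) : ℕ) : K)⁻¹ • logUnits K := by
  have h := closedBall_subset_logShell_ofUnitLog p K
  rwa [logShell_ofUnitLog] at h

/-- The printed bijection itself, for the real logarithm: `log_p` maps `1 + p*·𝒪_k` bijectively onto
`p*·𝒪_k`. [cite: MochizukiAbsTopIII2015, Def 5.4 (iii) p. 126] -/
theorem bijOn_unitLog_principalUnits :
    BijOn unitLog (closedBall (1 : K) ‖((p ^ (if p = 2 then 2 else 1) : ℕ) : K)‖)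
      (closedBall (0 : K) ‖((p ^ (if p = 2 then 2 else 1) : ℕ) : K)‖) := by
  have him := (PadicLogOnUnits.ofUnitLog p K).image_principalUnits
  have hin := (PadicLogOnUnits.ofUnitLog p K).injOn_principalUnits
  simp only [PadicLogOnUnits.ofUnitLog_pstar, PadicLogOnUnits.ofUnitLog_log] at him hin
  rw [← him]
  exact hin.bijOn_image

end Literature.AnabelianGeometry.AbsoluteAnabelian

end
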